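import Summits.BirchSwinnertonDyer.Rank1Residual.AdditivePotMult.RankOneHeegner
import Summits.BirchSwinnertonDyer.Rank1Residual.AdditivePotMult.TwistSupplyJ
import Summits.BirchSwinnertonDyer.Rank1Residual.X11b.TwistTransportRam
import Literature.NumberTheory.EllipticCurves.Rank1Residual.ClassX1KellerYinTypeA
import Summits.BirchSwinnertonDyer.Rank1Residual.Additive.GordTwistOrdinary
import Summits.BirchSwinnertonDyer.Rank1Residual.Additive.QuadraticTwistSurj
import Summits.BirchSwinnertonDyer.Rank1Residual.Additive.N10LowerHalfStatements
import Summits.BirchSwinnertonDyer.Rank1Residual.Additive.SemistableTwistAnalytic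
import Summits.BirchSwinnertonDyer.Rank1Residual.AdditivePotMult.Descent
import Literature.NumberTheory.EllipticCurves.Castella2018.TamagawaQuadraticBaseChangeProofs
import Literature.NumberTheory.EllipticCurves.CyclotomicIwasawaMainTheoremIrreducibleBaseChangeProofs
import Literature.NumberTheory.EllipticCurves.NonvanishingTwistsPrescribedRamificationSimpleZero
import Literature.NumberTheory.EllipticCurves.NonvanishingTwistsPrescribedRamificationSplit
import Literature.NumberTheory.EllipticCurves.BSDSelmerCMPConverseRankOneProofs
import Literature.NumberTheory.EllipticCurves.NonEisensteinPrimeOfSurjective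
import Literature.NumberTheory.EllipticCurves.BSDRootNumber
import Literature.NumberTheory.QuadraticFields.KroneckerSplitting
import HarnessLib

/-!
# Route `AdditiveBranchIMC` (rung K1), cruxes `GordTwoRankZeroOffCaseOne` (stmt-BirchSwinnertonDyer-19357,
# line `three_field_road` v3) and `MultLower` (stmt-BirchSwinnertonDyer-19359, line `tame_roads_mult` v3):
# the TAME TWIST TRANSPORT and FIELD 1 of the supply stubs `stub_fieldSupplyR0` / `stub_fieldSupplyM`

Cell `bsd-addord`, seat `bsd-line-addord-w2` (stub-worker under the LEAD of crux 19357). THEOREMS ONLY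
(no definition, no named fact, no `sorry`); every printed input is an explicit hypothesis
(Friedberg–Hoffstein Thm. B twins `friedbergHoffstein_exists_twist_simpleZero_ramifiedAt_splitAt` /
`…_ne_zero_ramifiedAt_splitAt`, the parity fact `even_analyticRank_iff_rootNumber_eq_one`, modularity
`hasEntireLFunction_rat`). Helper attached `--supports`; it closes no registered stub by itself (the line
files' vocabulary `WanPrime` / `TameRoadRow` / `TameRoadField` is not importable from `Theorems/`, so every
statement below spells those predicates out; the LEAD closes the stubs by `unfold`).

## §1 Transport along the TAME twist

`(E, p)` with `p ≥ 5` additive, `K` imaginary quadratic in which `p` SPLITS (`d_K ∈ (ℚ_p^×)²`,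
`p ∤ d_K`) and `2` splits (`d_K ≡ 1 (mod 8)`, so `d_K` is odd and square-free), `Wd = Cd • E^{(d_K)}` a
globally minimal model. Then (tree transports, assembled): `Addv`, `j`, `ord_p Δ_min` agree on `W`
and `Wd` (`AdditivePotMult.addv_iff_of_twist`, `j_of_model_twist`,
`X11b.padicValInt_minimalDiscriminantInt_twist_eq`); the N10
cells `CellGordTwo` (via the `p*`-partner: `typeGOrd_iff_goodOrd_twist_pStar` on both sides and
`isOrdinaryAt_of_smul_eq_quadraticTwist` for the good ordinary partner twisted by the `p`-unit `d_K`) and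
`CellM` transport; `Surj` transports (`Additive.surj_iff_of_model_twist`); and when the only bad prime of
`E` that does not split in `K` is a multiplicative `q` with `p ∤ v_q(Δ_min)`,
`ord_p ∏ c_ℓ(Wd) = ord_p ∏ c_ℓ(E)` (`Castella2018.TamagawaQuadratic.padicValNat_tamagawaProduct_quadraticTwist_eq`).

## §2 FIELD 1 of the two lines

From F6 (rank `0`: a tame-road field with a SIMPLE ZERO of `L(E^{(d_K)}, s)`) resp. F5 (rank `1`: a
non-zero VALUE), parity and modularity: the tame-road field `K` (imaginary, the Wan prime `q` ramified,
every other bad prime split, `2` split if `2 ∤ N`, `p` split) together with a globally minimal model `Wd`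
of `E^{(d_K)}` on the same cell, `Surj Wd p`, `p ∤ ∏ c(Wd)` and the complementary analytic rank.

FIELD 2 (the `p`-RAMIFIED Kolyvagin field) is NOT derivable from the lines' `PrintedFactsR0` /
`PrintedFactsM` (no conjunct delivers `L(Wd ⊗ η, 1) ≠ 0` for `η` ramified at the additive `p` with the class
at `q` prescribed); it is supplied in the companion files from Friedberg–Hoffstein Thm. B in the
Jetchev–Skinner–Wan form `friedbergHoffstein_exists_heegnerField_splitDivisors_twist_ne_zero`.

References: [SilvermanAEC2009] VII.5.1, VII.6.1, X.5.4; [JetchevSkinnerWan2017] §7.3.1, §7.4.1;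
[FriedbergHoffstein1995] Thm. B; [CaiShuTian2014] p. 2524.
-/

set_option linter.dupNamespace false

noncomputable section

open scoped Classical

open WeierstrassCurve NumberField IsDedekindDomain
  Literature.NumberTheory.EllipticCurves
  Literature.NumberTheory.EllipticCurves.Rank1Residual
  Literature.NumberTheory.QuadraticFields
  Summit.BirchSwinnertonDyer.Rank1Residual
  Summit.BirchSwinnertonDyer.Rank1Residual.Additive

namespace Summit.BirchSwinnertonDyer.BirchSwinnertonDyer.Theorems.ThreeFieldRoadSupply

/-! ### §1 Transport along the tame twist -/

section Transport

variable (W : WeierstrassCurve ℚ) [W.IsElliptic] [W.IsGloballyMinimal] (p : ℕ) [hp : Fact p.Prime]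
  (K : Type) [Field K] [NumberField K]

/-- `2` split in `K` ⟹ `d_K ≡ 1 (mod 8)`, in particular `d_K ≡ 1 (mod 4)`, odd and square-free.
[folklore] -/
theorem discr_emod_eight_of_two_split (hK : IsImaginaryQuadratic K)
    (h2 : ((Ideal.span {(2 : ℤ)}).primesOver (𝓞 K)).ncard = 2) :
    NumberField.discr K % 8 = 1 ∧ NumberField.discr K % 4 = 1 ∧ Odd (NumberField.discr K) ∧
      Squarefree (NumberField.discr K) := by
  have h8 : NumberField.discr K % 8 = 1 := (Quadratic.ncard_primesOver_two_eq_two_iff hK.1).mp h2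
  have h4 : NumberField.discr K % 4 = 1 := by omega
  refine ⟨h8, h4, Int.odd_iff.mpr (by omega), ?_⟩
  rcases Quadratic.isFundamentalDiscriminant_discr (K := K) hK.1 with ⟨-, hsq, -⟩ | ⟨h4d, -, -⟩
  · exact hsq
  · exfalso
    obtain ⟨k, hk⟩ := h4d
    omega

/-- A split odd prime `p` of `K`: `d_K` is a square in `ℚ_p` and `p ∤ d_K`. [folklore] -/
theorem isSquare_and_not_dvd_of_split (hK : IsImaginaryQuadratic K) (hp2 : p ≠ 2)
    (hsplit : SatisfiesHeegnerHypothesis p K) :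
    IsSquare (algebraMap ℚ ℚ_[p] (NumberField.discr K : ℚ)) ∧ ¬ (p : ℤ) ∣ NumberField.discr K := by
  have hs : ((Ideal.span {(p : ℤ)}).primesOver (𝓞 K)).ncard = 2 := hsplit p hp.out dvd_rfl
  refine ⟨?_, not_dvd_discr_of_split hK hp.out hp2 hsplit⟩
  have h := Castella2018.TamagawaQuadratic.isSquare_padic_discr_of_splitsIn hK.1 hs
  simpa using h

variable {Wd : WeierstrassCurve ℚ} [Wd.IsElliptic] [Wd.IsGloballyMinimal]

/-- **Cell (G-ord, `e = 2`) transports along the tame twist.** `p ≥ 5`, `K` imaginary quadratic with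
`p` and `2` split, `Wd = Cd • E^{(d_K)}` globally minimal: `N10.CellGordTwo W p → N10.CellGordTwo Wd p`.
`Addv` and `ord_p Δ_min` (hence `e`) transport because `d_K ∈ (ℚ_p^×)²`; (G)-ordinary transports through
the `p*`-partners: `V ≅ E^{(p*)}` is good ordinary (`typeGOrd_iff_goodOrd_twist_pStar`), its twist by the
`p`-unit square-free `d_K` is good ordinary (`isOrdinaryAt_of_smul_eq_quadraticTwist`), and that twist is
a model of `Wd^{(p*)}`. [cite: SilvermanAEC2009, X.5 Cor. 5.4 and VII.5 Prop. 5.1] -/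
theorem cellGordTwo_tameTwist (hp5 : 5 ≤ p) (hK : IsImaginaryQuadratic K)
    (hpK : SatisfiesHeegnerHypothesis p K) (h2K : ((Ideal.span {(2 : ℤ)}).primesOver (𝓞 K)).ncard = 2)
    (Cd : VariableChange ℚ) (hWd : Cd • W.quadraticTwist (NumberField.discr K : ℚ) = Wd)
    (hcell : N10.CellGordTwo W p) : N10.CellGordTwo Wd p := by
  have hp2 : p ≠ 2 := by omega
  set d : ℤ := NumberField.discr K with hd_def
  have hdZ : d ≠ 0 := NumberField.discr_ne_zero K
  have hD0 : (d : ℚ) ≠ 0 := by exact_mod_cast hdZ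
  obtain ⟨hsq, hpd⟩ := isSquare_and_not_dvd_of_split p K hK hp2 hpK
  obtain ⟨-, -, -, hsqf⟩ := discr_emod_eight_of_two_split K hK h2K
  obtain ⟨-, hadd, hG, he⟩ := hcell
  -- `Addv` and `ord_p Δ_min`
  have hsq' : IsSquare (((d : ℚ) : ℚ) : ℚ_[p]) := by simpa using hsq
  have haddd : Addv Wd p := (AdditivePotMult.addv_iff_of_twist hD0 hsq' Wd hWd).mpr hadd
  have hΔ : padicValInt p Wd.minimalDiscriminantInt = padicValInt p W.minimalDiscriminantInt :=
    X11b.padicValInt_minimalDiscriminantInt_twist_eq W p hD0 hsq Cd hWd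
  have hed : semistabilityIndex Wd p = 2 := by
    unfold semistabilityIndex at he ⊢
    rw [hΔ]
    exact he
  refine ⟨hp2, haddd, ?_, hed⟩
  -- (G)-ordinary via the `p*`-partners
  set ps : ℚ := (-1 : ℚ) ^ (p / 2) * p with hps
  have hps0 : ps ≠ 0 := mul_ne_zero (pow_ne_zero _ (by norm_num)) (by exact_mod_cast hp.out.ne_zero)
  obtain ⟨V, iV, iVm, CV, hCV⟩ := exists_isGloballyMinimal_smul_eq_quadraticTwist W hps0
  have hV : CV⁻¹ • W.quadraticTwist ps = V := by rw [← hCV, inv_smul_smul]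
  have hordV : GoodOrd V p := (typeGOrd_iff_goodOrd_twist_pStar W p hp5 he V CV⁻¹ hV).mp hG
  obtain ⟨Vd, iVd, iVdm, CVd, hCVd⟩ := exists_isGloballyMinimal_smul_eq_quadraticTwist V hD0
  have hordVd : IsOrdinaryAt Vd p :=
    isOrdinaryAt_of_smul_eq_quadraticTwist V Vd hsqf hCVd p hp2 hpd ⟨hordV.1, hordV.2⟩
  have hgoVd : GoodOrd Vd p := ⟨hordVd.1, hordVd.2⟩
  -- `Vd` is a model of `Wd^{(p*)}`: `Wd^{(p*)} ≅ E^{(d_K p*)} ≅ (E^{(p*)})^{(d_K)} ≅ V^{(d_K)} ≅ Vd`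
  have h1 : ∃ C : VariableChange ℚ, C • Wd.quadraticTwist ps = Vd := by
    -- `Wd^{(ps)} = C₁ • E^{(d ps)}`
    have e1 : Wd.quadraticTwist ps =
        (⟨Cd.u, ps * Cd.r, 0, 0⟩ : VariableChange ℚ) • W.quadraticTwist ((d : ℚ) * ps) := by
      rw [← hWd, WeierstrassCurve.quadraticTwist_smul, quadraticTwist_quadraticTwist]
    -- `V^{(d)} = C₂ • E^{(ps d)}`
    have e2 : V.quadraticTwist (d : ℚ) =
        (⟨CV⁻¹.u, (d : ℚ) * CV⁻¹.r, 0, 0⟩ : VariableChange ℚ) • W.quadraticTwist (ps * (d : ℚ)) := by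
      rw [← hV, WeierstrassCurve.quadraticTwist_smul, quadraticTwist_quadraticTwist]
    refine ⟨CVd⁻¹ * (⟨CV⁻¹.u, (d : ℚ) * CV⁻¹.r, 0, 0⟩ : VariableChange ℚ) *
      (⟨Cd.u, ps * Cd.r, 0, 0⟩ : VariableChange ℚ)⁻¹, ?_⟩
    rw [mul_smul, mul_smul, e1, inv_smul_smul, mul_comm (d : ℚ) ps, ← e2, ← hCVd, inv_smul_smul]
  obtain ⟨C₃, hC₃⟩ := h1
  exact (typeGOrd_iff_goodOrd_twist_pStar Wd p hp5 hed Vd C₃ hC₃).mpr hgoVd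

omit [W.IsGloballyMinimal] [Wd.IsGloballyMinimal] in
/-- **Cell (M) transports along the tame twist** (`p` odd, split in `K`): `N10.CellM W p → N10.CellM Wd p`
(`Addv` by `addv_iff_of_twist`, `ord_p j < 0` because `j` is a twist invariant). [cite: SilvermanAEC2009, X.5 Cor. 5.4] -/
theorem cellM_tameTwist (hp2 : p ≠ 2) (hK : IsImaginaryQuadratic K) (hpK : SatisfiesHeegnerHypothesis p K)
    (Cd : VariableChange ℚ) (hWd : Cd • W.quadraticTwist (NumberField.discr K : ℚ) = Wd)
    (hcell : N10.CellM W p) : N10.CellM Wd p := by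
  have hD0 : (NumberField.discr K : ℚ) ≠ 0 := by exact_mod_cast NumberField.discr_ne_zero K
  obtain ⟨hsq, -⟩ := isSquare_and_not_dvd_of_split p K hK hp2 hpK
  have hsq' : IsSquare (((NumberField.discr K : ℚ) : ℚ) : ℚ_[p]) := by simpa using hsq
  have hj : Wd.j = W.j := AdditivePotMult.j_of_model_twist hD0 ⟨Cd, hWd⟩
  refine ⟨hp2, (AdditivePotMult.addv_iff_of_twist hD0 hsq' Wd hWd).mpr hcell.2.1, ?_⟩
  unfold PotMult
  rw [hj]
  exact hcell.2.2

omit [W.IsGloballyMinimal] [Wd.IsElliptic] [Wd.IsGloballyMinimal] in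
/-- `Surj` transports along any quadratic twist (`Additive.surj_iff_of_model_twist`). [cite: SilvermanAEC2009, X.5 Cor. 5.4] -/
theorem surj_tameTwist (Cd : VariableChange ℚ) (hWd : Cd • W.quadraticTwist (NumberField.discr K : ℚ) = Wd)
    (hs : Surj W p) : Surj Wd p := by
  have hD0 : (NumberField.discr K : ℚ) ≠ 0 := by exact_mod_cast NumberField.discr_ne_zero K
  exact (Additive.surj_iff_of_model_twist W p hD0 ⟨Cd, hWd⟩).mpr hs

omit [Wd.IsGloballyMinimal] in
/-- **`ord_p ∏ c(Wd) = ord_p ∏ c(E)` along the tame twist** (`p ≥ 5`): the only bad prime of `E` that does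
not split in `K` is the multiplicative Wan prime `q`, at which `p ∤ v_q(Δ_min)`, so the bad-prime hypothesis
of `padicValNat_tamagawaProduct_quadraticTwist_eq` holds. [cite: JetchevSkinnerWan2017, §7.3.1 (eq:tamK)]
[cite: SilvermanAEC2009, Thm VII.6.1] -/
theorem padicValNat_tamagawaProduct_tameTwist (hp5 : 5 ≤ p) (hK : IsImaginaryQuadratic K)
    {q : ℕ} [Fact q.Prime] (hqm : W.HasMultiplicativeReductionAtPrime q)
    (hqv : ¬ p ∣ padicValInt q W.minimalDiscriminantInt)
    (hsplit : ∀ ℓ : ℕ, ℓ.Prime → ℓ ∣ W.conductorNorm ℤ → ℓ ≠ q →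
      ((Ideal.span {(ℓ : ℤ)}).primesOver (𝓞 K)).ncard = 2)
    (hWd : ∃ C : VariableChange ℚ, C • W.quadraticTwist (NumberField.discr K : ℚ) = Wd) :
    padicValNat p Wd.tamagawaProduct = padicValNat p W.tamagawaProduct := by
  refine Castella2018.TamagawaQuadratic.padicValNat_tamagawaProduct_quadraticTwist_eq W p K Wd hp5 hK.1
    (fun ℓ _ hℓN hns ↦ ?_) hWd
  have hℓq : ℓ = q := by
    by_contra h
    exact hns (hsplit ℓ Fact.out hℓN h)
  subst hℓq
  exact ⟨hqm, hqv⟩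

omit [Wd.IsGloballyMinimal] in
/-- `p ∤ ∏ c(E) ⟹ p ∤ ∏ c(Wd)` along the tame twist (`p ≥ 5`). [cite: SilvermanAEC2009, Thm VII.6.1] -/
theorem not_dvd_tamagawaProduct_tameTwist (hp5 : 5 ≤ p) (hK : IsImaginaryQuadratic K)
    {q : ℕ} [Fact q.Prime] (hqm : W.HasMultiplicativeReductionAtPrime q)
    (hqv : ¬ p ∣ padicValInt q W.minimalDiscriminantInt)
    (hsplit : ∀ ℓ : ℕ, ℓ.Prime → ℓ ∣ W.conductorNorm ℤ → ℓ ≠ q →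
      ((Ideal.span {(ℓ : ℤ)}).primesOver (𝓞 K)).ncard = 2)
    (hWd : ∃ C : VariableChange ℚ, C • W.quadraticTwist (NumberField.discr K : ℚ) = Wd)
    (htam : ¬ p ∣ W.tamagawaProduct) : ¬ p ∣ Wd.tamagawaProduct := by
  have hv := padicValNat_tamagawaProduct_tameTwist W p K hp5 hK hqm hqv hsplit hWd
  intro hdvd
  have hne : Wd.tamagawaProduct ≠ 0 := (Wd.tamagawaProduct_pos_holds).ne'
  have h1 : 1 ≤ padicValNat p Wd.tamagawaProduct :=
    (padicValNat_dvd_iff_le hne).mp (by simpa using hdvd)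
  rw [hv] at h1
  have h0 : padicValNat p W.tamagawaProduct = 0 := padicValNat.eq_zero_of_not_dvd htam
  omega

end Transport

/-! ### §2 Analytic ranks of the twist from the printed `L`-values -/

section Analytic

variable (W : WeierstrassCurve ℚ) [W.IsElliptic] (K : Type) [Field K] [NumberField K]
  {Wd : WeierstrassCurve ℚ} [Wd.IsElliptic]

omit [Wd.IsElliptic] in
/-- A simple zero of `L(E^{(d_K)}, s)` at `s = 1` ⟹ `r_an(Wd) = 1` for any model `Wd` of the twist
(modularity for the entire continuation; `analyticRank_smul`). [cite: SilvermanAEC2009, App. C §16] -/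
theorem analyticRank_eq_one_tameTwist (hmod : hasEntireLFunction_rat) (Cd : VariableChange ℚ)
    (hWd : Cd • W.quadraticTwist (NumberField.discr K : ℚ) = Wd)
    (h0 : (W.quadraticTwist (NumberField.discr K : ℚ)).entireLFunction 1 = 0)
    (h1 : deriv (W.quadraticTwist (NumberField.discr K : ℚ)).entireLFunction 1 ≠ 0) :
    Wd.analyticRank = 1 := by
  have hD0 : (NumberField.discr K : ℚ) ≠ 0 := by exact_mod_cast NumberField.discr_ne_zero K
  haveI := W.isElliptic_quadraticTwist hD0
  rw [← hWd, analyticRank_smul]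
  exact analyticRank_eq_one_of_entireLFunction_one_eq_zero_of_deriv_ne_zero _ (hmod _) h0 h1

omit [Wd.IsElliptic] in
/-- `L(E^{(d_K)}, 1) ≠ 0` ⟹ `r_an(Wd) = 0` for any model `Wd` of the twist. [cite: SilvermanAEC2009, App. C §16] -/
theorem analyticRank_eq_zero_tameTwist (hmod : hasEntireLFunction_rat) (Cd : VariableChange ℚ)
    (hWd : Cd • W.quadraticTwist (NumberField.discr K : ℚ) = Wd)
    (h1 : (W.quadraticTwist (NumberField.discr K : ℚ)).entireLFunction 1 ≠ 0) :
    Wd.analyticRank = 0 := by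
  have hD0 : (NumberField.discr K : ℚ) ≠ 0 := by exact_mod_cast NumberField.discr_ne_zero K
  haveI := W.isElliptic_quadraticTwist hD0
  rw [← hWd, analyticRank_smul]
  exact ((W.quadraticTwist _).analyticRank_eq_zero_iff_holds (hmod _)).2 h1

/-- Parity: `r_an(E) = 0 ⟹ w(E) = +1`, `r_an(E) = 1 ⟹ w(E) = −1`. [cite: DokchitserDokchitser2010, Thm. 1.4] -/
theorem rootNumber_of_analyticRank_le_one
    (hpar : ∀ X : WeierstrassCurve ℚ, even_analyticRank_iff_rootNumber_eq_one X) :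
    (W.analyticRank = 0 → W.rootNumber = 1) ∧ (W.analyticRank = 1 → W.rootNumber = -1) := by
  refine ⟨fun hr ↦ (hpar W).mp (by rw [hr]; exact Even.zero), fun hr ↦ ?_⟩
  rcases W.rootNumber_eq_one_or with h | h
  · exfalso
    have heven : Even W.analyticRank := (hpar W).mpr h
    rw [hr] at heven
    exact Nat.not_even_one heven
  · exact h

end Analytic

/-! ### §3 FIELD 1: the tame-road field and the twist on the same cell -/

section FieldOne

variable (W : WeierstrassCurve ℚ) [W.IsElliptic] [W.IsGloballyMinimal] (p : ℕ) [hp : Fact p.Prime]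

/-- **FIELD 1 on the (G-ord, `e = 2`) cell, analytic rank `0`** (the `(K, Wd)` half of `stub_fieldSupplyR0`
of line `three_field_road` v3, with `TameRoadField` spelled out). For `(E, p)` on the cell with `p ≥ 5`,
`ρ̄_{E,p}` onto, `p ∤ ∏ c(E)`, `r_an(E) = 0`, and a Wan prime `q` (`q ≠ p`, `q ≠ 2`, non-split multiplicative,
`p ∤ v_q(Δ_min)`): parity gives `w(E) = +1`; F6 (`friedbergHoffstein_exists_twist_simpleZero_ramifiedAt_splitAt`)
an imaginary quadratic `K` with `q` ramified, every other bad prime split, `2` split if `2 ∤ N`, `p` split and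
a SIMPLE zero of `L(E^{(d_K)}, s)` at `s = 1`; a globally minimal model `Wd` of the twist has `r_an = 1`
(modularity), lies on the cell (§1), has `ρ̄` onto and `p ∤ ∏ c(Wd)`.
[cite: FriedbergHoffstein1995, Thm. B (second alternative)] [cite: CastellaWan2023, proof of Thm. 6.11 (MS p. 33)]
[cite: SilvermanAEC2009, X.5 Cor. 5.4 and Thm VII.6.1] -/
theorem exists_fieldOne_gordTwo_rankZero
    (hFH : friedbergHoffstein_exists_twist_simpleZero_ramifiedAt_splitAt)
    (hpar : ∀ X : WeierstrassCurve ℚ, even_analyticRank_iff_rootNumber_eq_one X)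
    (hmod : hasEntireLFunction_rat)
    (hp5 : 5 ≤ p) (hr : W.analyticRank = 0) (hcell : N10.CellGordTwo W p) (hsurj : Surj W p)
    (htam : ¬ p ∣ W.tamagawaProduct) {q : ℕ} [Fact q.Prime] (hqp : q ≠ p) (hq2 : q ≠ 2)
    (hqm : W.HasMultiplicativeReductionAtPrime q) (hqns : ¬ W.HasSplitMultiplicativeReductionAtPrime q)
    (hqv : ¬ p ∣ padicValInt q W.minimalDiscriminantInt) :
    ∃ (K : Type) (_ : Field K) (_ : NumberField K)
      (Wd : WeierstrassCurve ℚ) (_ : Wd.IsElliptic) (_ : Wd.IsGloballyMinimal),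
      IsImaginaryQuadratic K ∧ (q : ℤ) ∣ NumberField.discr K ∧
        (∀ ℓ : ℕ, ℓ.Prime → ℓ ∣ W.conductorNorm ℤ → ℓ ≠ q →
          ((Ideal.span {(ℓ : ℤ)}).primesOver (𝓞 K)).ncard = 2) ∧
        (¬ 2 ∣ W.conductorNorm ℤ → ((Ideal.span {(2 : ℤ)}).primesOver (𝓞 K)).ncard = 2) ∧
        SatisfiesHeegnerHypothesis p K ∧
        ((Ideal.span {(2 : ℤ)}).primesOver (𝓞 K)).ncard = 2 ∧
        (∃ C : VariableChange ℚ, C • W.quadraticTwist (NumberField.discr K : ℚ) = Wd) ∧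
        Wd.analyticRank = 1 ∧ N10.CellGordTwo Wd p ∧ Surj Wd p ∧ ¬ p ∣ Wd.tamagawaProduct := by
  have hw : W.rootNumber = 1 := (rootNumber_of_analyticRank_le_one W hpar).1 hr
  obtain ⟨K, iF, iN, hK, -, hqd, hsplit, h2, hpK, hL0, hL1⟩ :=
    hFH W hw q hqm hqns p hp.out hqp.symm 0
  -- `2` splits in `K` in either case
  have h2K : ((Ideal.span {(2 : ℤ)}).primesOver (𝓞 K)).ncard = 2 := by
    by_cases h2N : 2 ∣ W.conductorNorm ℤ
    · exact hsplit 2 Nat.prime_two h2N (Ne.symm hq2)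
    · exact h2 h2N
  have hD0 : (NumberField.discr K : ℚ) ≠ 0 := by exact_mod_cast NumberField.discr_ne_zero K
  obtain ⟨Wd, iWd, iWdm, Cd', hCd'⟩ := exists_isGloballyMinimal_smul_eq_quadraticTwist W hD0
  have hWd : Cd'⁻¹ • W.quadraticTwist (NumberField.discr K : ℚ) = Wd := by rw [← hCd', inv_smul_smul]
  refine ⟨K, iF, iN, Wd, iWd, iWdm, hK, hqd, hsplit, h2, hpK, h2K, ⟨Cd'⁻¹, hWd⟩, ?_, ?_, ?_, ?_⟩
  · exact analyticRank_eq_one_tameTwist W K hmod Cd'⁻¹ hWd hL0 hL1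
  · exact cellGordTwo_tameTwist W p K hp5 hK hpK h2K Cd'⁻¹ hWd hcell
  · exact surj_tameTwist W p K Cd'⁻¹ hWd hsurj
  · exact not_dvd_tamagawaProduct_tameTwist W p K hp5 hK hqm hqv hsplit ⟨Cd'⁻¹, hWd⟩ htam

/-- **FIELD 1 on the (M) cell, analytic rank `≤ 1`** (the `(K, Wd)` half of `stub_fieldSupplyM` of line
`tame_roads_mult` v3, with `TameRoadField` spelled out). As above, with F5
(`friedbergHoffstein_exists_twist_ne_zero_ramifiedAt_splitAt`, `w(E) = −1`) in rank `1` and F6 in rank `0`: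
`r_an(E) + r_an(Wd) = 1`, `Wd` on cell (M), of class X4 (`ρ̄_{Wd,p}` onto ⟹ `Wd[p]` irreducible), and
`p ∤ ∏ c(E) → p ∤ ∏ c(Wd)`. [cite: FriedbergHoffstein1995, Thm. B] [cite: Castella2018, §5 (arXiv:1704.06608 p. 12)]
[cite: SilvermanAEC2009, X.5 Cor. 5.4 and Thm VII.6.1] -/
theorem exists_fieldOne_mult_rankLeOne
    (hF5 : friedbergHoffstein_exists_twist_ne_zero_ramifiedAt_splitAt)
    (hF6 : friedbergHoffstein_exists_twist_simpleZero_ramifiedAt_splitAt)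
    (hpar : ∀ X : WeierstrassCurve ℚ, even_analyticRank_iff_rootNumber_eq_one X)
    (hmod : hasEntireLFunction_rat)
    (hp5 : 5 ≤ p) (hr : W.analyticRank ≤ 1) (hcell : N10.CellM W p) (hsurj : Surj W p)
    {q : ℕ} [Fact q.Prime] (hqp : q ≠ p) (hq2 : q ≠ 2)
    (hqm : W.HasMultiplicativeReductionAtPrime q) (hqns : ¬ W.HasSplitMultiplicativeReductionAtPrime q)
    (hqv : ¬ p ∣ padicValInt q W.minimalDiscriminantInt) :
    ∃ (K : Type) (_ : Field K) (_ : NumberField K)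
      (Wd : WeierstrassCurve ℚ) (_ : Wd.IsElliptic) (_ : Wd.IsGloballyMinimal),
      IsImaginaryQuadratic K ∧ (q : ℤ) ∣ NumberField.discr K ∧
        (∀ ℓ : ℕ, ℓ.Prime → ℓ ∣ W.conductorNorm ℤ → ℓ ≠ q →
          ((Ideal.span {(ℓ : ℤ)}).primesOver (𝓞 K)).ncard = 2) ∧
        (¬ 2 ∣ W.conductorNorm ℤ → ((Ideal.span {(2 : ℤ)}).primesOver (𝓞 K)).ncard = 2) ∧
        SatisfiesHeegnerHypothesis p K ∧
        ((Ideal.span {(2 : ℤ)}).primesOver (𝓞 K)).ncard = 2 ∧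
        (∃ C : VariableChange ℚ, C • W.quadraticTwist (NumberField.discr K : ℚ) = Wd) ∧
        W.analyticRank + Wd.analyticRank = 1 ∧ N10.CellM Wd p ∧ AdditivePotMult.ClassX4M Wd p ∧
        Surj Wd p ∧ (¬ p ∣ W.tamagawaProduct → ¬ p ∣ Wd.tamagawaProduct) := by
  have hp2 : p ≠ 2 := by omega
  -- the field, with the complementary `L`-value
  obtain ⟨K, iF, iN, hK, hqd, hsplit, h2, hpK, hL⟩ : ∃ (K : Type) (_ : Field K) (_ : NumberField K),
      IsImaginaryQuadratic K ∧ (q : ℤ) ∣ NumberField.discr K ∧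
        (∀ ℓ : ℕ, ℓ.Prime → ℓ ∣ W.conductorNorm ℤ → ℓ ≠ q →
          ((Ideal.span {(ℓ : ℤ)}).primesOver (𝓞 K)).ncard = 2) ∧
        (¬ 2 ∣ W.conductorNorm ℤ → ((Ideal.span {(2 : ℤ)}).primesOver (𝓞 K)).ncard = 2) ∧
        SatisfiesHeegnerHypothesis p K ∧
        ((W.analyticRank = 1 ∧ (W.quadraticTwist (NumberField.discr K : ℚ)).entireLFunction 1 ≠ 0) ∨
          (W.analyticRank = 0 ∧ (W.quadraticTwist (NumberField.discr K : ℚ)).entireLFunction 1 = 0 ∧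
            deriv (W.quadraticTwist (NumberField.discr K : ℚ)).entireLFunction 1 ≠ 0)) := by
    rcases Nat.le_one_iff_eq_zero_or_eq_one.mp hr with hr0 | hr1
    · have hw : W.rootNumber = 1 := (rootNumber_of_analyticRank_le_one W hpar).1 hr0
      obtain ⟨K, iF, iN, hK, -, hqd, hsplit, h2, hpK, hL0, hL1⟩ :=
        hF6 W hw q hqm hqns p hp.out hqp.symm 0
      exact ⟨K, iF, iN, hK, hqd, hsplit, h2, hpK, Or.inr ⟨hr0, hL0, hL1⟩⟩
    · have hw : W.rootNumber = -1 := (rootNumber_of_analyticRank_le_one W hpar).2 hr1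
      obtain ⟨K, iF, iN, hK, -, hqd, hsplit, h2, hpK, hL⟩ :=
        hF5 W hw q hqm hqns p hp.out hqp.symm 0
      exact ⟨K, iF, iN, hK, hqd, hsplit, h2, hpK, Or.inl ⟨hr1, hL⟩⟩
  have h2K : ((Ideal.span {(2 : ℤ)}).primesOver (𝓞 K)).ncard = 2 := by
    by_cases h2N : 2 ∣ W.conductorNorm ℤ
    · exact hsplit 2 Nat.prime_two h2N (Ne.symm hq2)
    · exact h2 h2N
  have hD0 : (NumberField.discr K : ℚ) ≠ 0 := by exact_mod_cast NumberField.discr_ne_zero K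
  obtain ⟨Wd, iWd, iWdm, Cd', hCd'⟩ := exists_isGloballyMinimal_smul_eq_quadraticTwist W hD0
  have hWd : Cd'⁻¹ • W.quadraticTwist (NumberField.discr K : ℚ) = Wd := by rw [← hCd', inv_smul_smul]
  have hcelld : N10.CellM Wd p := cellM_tameTwist W p K hp2 hK hpK Cd'⁻¹ hWd hcell
  have hsurjd : Surj Wd p := surj_tameTwist W p K Cd'⁻¹ hWd hsurj
  have hX4 : AdditivePotMult.ClassX4M Wd p :=
    ⟨⟨hp2, hcelld.2.1, hasIrreducibleModPGaloisRep_of_hasSurjectiveModNGaloisRep Wd p hsurjd⟩,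
      hcelld.2.1, hcelld.2.2⟩
  refine ⟨K, iF, iN, Wd, iWd, iWdm, hK, hqd, hsplit, h2, hpK, h2K, ⟨Cd'⁻¹, hWd⟩, ?_, hcelld, hX4, hsurjd,
    fun htam ↦ not_dvd_tamagawaProduct_tameTwist W p K hp5 hK hqm hqv hsplit ⟨Cd'⁻¹, hWd⟩ htam⟩
  rcases hL with ⟨hr1, hL⟩ | ⟨hr0, hL0, hL1⟩
  · rw [hr1, analyticRank_eq_zero_tameTwist W K hmod Cd'⁻¹ hWd hL]
  · rw [hr0, analyticRank_eq_one_tameTwist W K hmod Cd'⁻¹ hWd hL0 hL1]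

end FieldOne

end Summit.BirchSwinnertonDyer.BirchSwinnertonDyer.Theorems.ThreeFieldRoadSupply

end
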